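import Mathlib.Analysis.Calculus.Taylor
import Mathlib.Analysis.Calculus.IteratedDeriv.Lemmas
import Mathlib.Analysis.Calculus.ContDiff.Deriv
import Literature.Analysis.Calculus.WhitneyConvexGluing
import HarnessLib

/-!
# Extension of `Cᴺ` functions (`N` finite) from a closed interval or a closed half-line

Topic `Analysis/Calculus`; theorems only, no named facts.  **The result** (Whitney's extension
theorem, case `m` finite, in dimension one; folklore "Taylor continuation"): if `f : ℝ → F`
(`F` a real normed space) is of class `Cᴺ`, `N : ℕ`, on the closed half-line `[a, ∞)` or on a
compact interval `[a, b]` (`a < b`) in Mathlib's *within* sense — i.e. the derivatives within the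
interval of orders `≤ N` exist and are continuous up to the endpoints — then there is a function
`G : ℝ → F` of class `Cᴺ` on the whole line with `G = f` on the interval and whose derivatives of
orders `m ≤ N` at every point of the interval (endpoints included) are the one-sided /
within-derivatives of `f` (`Literature.Analysis.Calculus.exists_contDiff_extension_Ici`,
`Literature.Analysis.Calculus.exists_contDiff_extension_Icc`; first-derivative corollaries
`…_Ici_deriv`, `…_Icc_deriv`, and the `C²`-on-`[0, L]` shape `exists_contDiff_two_extension_Icc`).

**Construction.** Continue `f` beyond an endpoint `a` by its Taylor polynomial of order `N`
within the interval at `a` (Mathlib's `taylorWithinEval f N K a`, a polynomial in the evaluation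
point: `contDiff_taylorWithinEval`), whose derivatives of orders `m ≤ N` at `a` are the
within-derivatives of `f` (`iteratedDeriv_taylorWithinEval_self`, from Mathlib's
`hasDerivAt_taylorWithinEval_succ`).  Off the interval the glued function is locally a polynomial;
at the endpoints its derivatives tend from outside to the within-derivatives of `f`
(`tendsto_iteratedDeriv_of_eqOn_taylor_left/right`), so the tree's gluing theorem for jets on a
closed set with unique derivatives
(`Literature.Analysis.Calculus.WhitneyConvex.contDiff_of_tendsto_iteratedFDeriv`,
`WhitneyConvexGluing.lean`; Whitney (1934) §11) applies, here in its one-variable form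
`contDiff_of_tendsto_iteratedDeriv`.

**Why it is here.** The tree has Whitney's theorem on convex bodies and Seeley's theorem on
half-spaces only for `C^∞` data (`WhitneyExtension.lean`, `SeeleyExtension.lean`), and the smooth
"squash" `exists_contDiff_eqOn_Icc` (`SmoothIntervalExtension.lean`) needs the function to be
smooth on a larger *open* interval.  Hypotheses of the form "`G ∈ C²(ℝ)` with `G′(0) = e′`" fed by a
function known only on `[0, ∞)` or `[0, L]` together with its right derivative at `0` — e.g. the
even density `G(|x|)` of `Literature.NumberTheory.ConnesConsani2021.evenFunctional` in
`JumpFormula.lean` / `MainInequalityAssembly.lean` ("any `C²` function on `[0, ∞)` is the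
restriction of a `C²` function on `ℝ`, and only two derivatives enter") — are discharged from
one-sided regularity by the theorems of this file.  No statement about any number-theoretic
object is made here.

## References

* H. Whitney, *Analytic extensions of differentiable functions defined in closed sets*, Trans.
  Amer. Math. Soc. 36 (1934), 63–89, Thm. I (case `m` finite) and §11. [Whitney1934]
* Mathlib, `taylorWithinEval`, `hasDerivAt_taylorWithinEval_succ`
  (`Mathlib.Analysis.Calculus.Taylor`).
-/

noncomputable section

open Set Filter
open scoped ContDiff Topology Nat

namespace Literature.Analysis.Calculus

variable {F : Type*} [NormedAddCommGroup F] [NormedSpace ℝ F]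

/-! ### The Taylor polynomial as a function of the evaluation point -/

/-- The Taylor polynomial `x ↦ ∑_{i ≤ n} (i!)⁻¹ (x - x₀)ⁱ • f⁽ⁱ⁾_s(x₀)` is smooth in the evaluation
point `x`. [folklore] -/
private theorem contDiff_taylorWithinEval (f : ℝ → F) (n : ℕ) (s : Set ℝ) (x₀ : ℝ)
    {k : WithTop ℕ∞} : ContDiff ℝ k (taylorWithinEval f n s x₀) := by
  have h : taylorWithinEval f n s x₀ = fun x ↦ ∑ i ∈ Finset.range (n + 1),
      ((i ! : ℝ)⁻¹ * (x - x₀) ^ i) • iteratedDerivWithin i f s x₀ := by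
    funext x
    exact taylor_within_apply f n s x₀ x
  rw [h]
  exact ContDiff.sum fun i _ ↦
    (contDiff_const.mul ((contDiff_id.sub contDiff_const).pow i)).smul contDiff_const

/-- The derivative in the evaluation point of the Taylor polynomial of order `n + 1` of `f` is the
Taylor polynomial of order `n` of the within-derivative of `f` (function form of Mathlib's
`hasDerivAt_taylorWithinEval_succ`). [folklore] -/
private theorem deriv_taylorWithinEval_succ (f : ℝ → F) (n : ℕ) (s : Set ℝ) (x₀ : ℝ) :
    deriv (taylorWithinEval f (n + 1) s x₀) = taylorWithinEval (derivWithin f s) n s x₀ := by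
  funext x
  exact (hasDerivAt_taylorWithinEval_succ f n).deriv

/-- **The jet of the Taylor polynomial at its base point**: for `m ≤ n`, the `m`-th derivative at
`x₀` of the Taylor polynomial of order `n` of `f` within `s` at `x₀` is the `m`-th derivative of `f`
within `s` at `x₀`. [folklore] -/
private theorem iteratedDeriv_taylorWithinEval_self {f : ℝ → F} {s : Set ℝ} {x₀ : ℝ} {m n : ℕ}
    (hmn : m ≤ n) :
    iteratedDeriv m (taylorWithinEval f n s x₀) x₀ = iteratedDerivWithin m f s x₀ := by
  induction m generalizing f n with
  | zero => simp
  | succ m ih =>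
    obtain ⟨n, rfl⟩ : ∃ n', n = n' + 1 := ⟨n - 1, by omega⟩
    rw [iteratedDeriv_succ', deriv_taylorWithinEval_succ, ih (by omega), iteratedDerivWithin_succ']

/-! ### Gluing in one variable -/

/-- **Gluing a jet on a closed subset of `ℝ` to a `Cᴺ` function off it**, one-variable form of
`Literature.Analysis.Calculus.WhitneyConvex.contDiff_of_tendsto_iteratedFDeriv`: if `K ⊆ ℝ` is
closed with unique derivatives, `f` is `Cᴺ` within `K`, `g = f` on `K`, `g` is `Cᴺ` on `Kᶜ`, and at
every point of `K` the derivatives `g⁽ᵐ⁾`, `m ≤ N`, tend from `Kᶜ` to the within-derivatives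
`f⁽ᵐ⁾_K`, then `g` is `Cᴺ` on `ℝ` and `g⁽ᵐ⁾ = f⁽ᵐ⁾_K` on `K` for `m ≤ N`.
[cite: Whitney1934, §11 (case m finite)] -/
theorem contDiff_of_tendsto_iteratedDeriv {K : Set ℝ} {f g : ℝ → F} {N : ℕ} (hK : IsClosed K)
    (hKu : UniqueDiffOn ℝ K) (hf : ContDiffOn ℝ N f K) (hg : ContDiffOn ℝ N g Kᶜ)
    (hfg : EqOn g f K)
    (hlim : ∀ m : ℕ, m ≤ N → ∀ x ∈ K,
      Tendsto (iteratedDeriv m g) (𝓝[Kᶜ] x) (𝓝 (iteratedDerivWithin m f K x))) :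
    ContDiff ℝ N g ∧
      ∀ m : ℕ, m ≤ N → ∀ x ∈ K, iteratedDeriv m g x = iteratedDerivWithin m f K x := by
  have hlim' : ∀ m : ℕ, m ≤ N → ∀ x ∈ K,
      Tendsto (iteratedFDeriv ℝ m g) (𝓝[Kᶜ] x) (𝓝 (iteratedFDerivWithin ℝ m f K x)) := by
    intro m hm x hx
    rw [iteratedFDeriv_eq_equiv_comp, iteratedFDerivWithin_eq_equiv_comp]
    exact ((ContinuousMultilinearMap.piFieldEquiv ℝ (Fin m) F).continuous.tendsto _).comp
      (hlim m hm x hx)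
  refine ⟨WhitneyConvex.contDiff_of_tendsto_iteratedFDeriv hK hKu hf hg hfg hlim',
    fun m hm x hx ↦ ?_⟩
  rw [iteratedDeriv_eq_iteratedFDeriv, iteratedDerivWithin_eq_iteratedFDerivWithin,
    WhitneyConvex.iteratedFDeriv_eq_of_tendsto_iteratedFDeriv hK hKu hf hg hfg hlim' hm hx]

/-- At an interior point of `K` there is nothing to check: `𝓝[Kᶜ] x = ⊥`. [folklore] -/
private theorem tendsto_nhdsWithin_compl_of_mem_interior {X : Type*} [TopologicalSpace X]
    {K : Set ℝ} {x : ℝ} (hx : x ∈ interior K) {u : ℝ → X} {l : Filter X} :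
    Tendsto u (𝓝[Kᶜ] x) l := by
  have h : x ∉ closure Kᶜ := by
    rw [closure_compl]
    exact fun h ↦ h hx
  rw [notMem_closure_iff_nhdsWithin_eq_bot.1 h]
  exact tendsto_bot

/-- **Derivatives of the Taylor continuation at a left endpoint.**  Let `a ∈ K`, suppose that near
`a` the complement of `K` lies to the left of `a` (`y ∉ K`, `y < c` imply `y < a`, for some
`c > a`),
and that `g` agrees on `(-∞, a)` with the Taylor polynomial of order `n` of `f` within `K` at `a`.
Then for `m ≤ n` the derivative `g⁽ᵐ⁾` tends, from `Kᶜ`, to `f⁽ᵐ⁾_K(a)`. [folklore] -/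
private theorem tendsto_iteratedDeriv_of_eqOn_taylor_left {K : Set ℝ} {f g : ℝ → F} {n m : ℕ}
    {a c : ℝ} (hm : m ≤ n) (hac : a < c) (hKc : ∀ y ∈ Kᶜ, y < c → y < a)
    (hg : EqOn g (taylorWithinEval f n K a) (Iio a)) :
    Tendsto (iteratedDeriv m g) (𝓝[Kᶜ] a) (𝓝 (iteratedDerivWithin m f K a)) := by
  have hP : Tendsto (iteratedDeriv m (taylorWithinEval f n K a)) (𝓝[Kᶜ] a)
      (𝓝 (iteratedDerivWithin m f K a)) := by
    rw [← iteratedDeriv_taylorWithinEval_self hm]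
    exact (((contDiff_taylorWithinEval f n K a).continuous_iteratedDeriv' m).tendsto a).mono_left
      nhdsWithin_le_nhds
  refine hP.congr' ?_
  have hc : ∀ᶠ y in 𝓝[Kᶜ] a, y ∈ Kᶜ ∧ y ∈ Iio c :=
    eventually_mem_nhdsWithin.and (mem_nhdsWithin_of_mem_nhds (Iio_mem_nhds hac))
  filter_upwards [hc] with y hy
  have hya : y < a := hKc y hy.1 hy.2
  have hloc : g =ᶠ[𝓝 y] taylorWithinEval f n K a := by
    filter_upwards [Iio_mem_nhds hya] with z hz using hg hz
  rw [iteratedDeriv_eq_iteratedFDeriv, iteratedDeriv_eq_iteratedFDeriv,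
    (hloc.iteratedFDeriv ℝ m).eq_of_nhds]

/-- **Derivatives of the Taylor continuation at a right endpoint** (mirror image of
`tendsto_iteratedDeriv_of_eqOn_taylor_left`). [folklore] -/
private theorem tendsto_iteratedDeriv_of_eqOn_taylor_right {K : Set ℝ} {f g : ℝ → F} {n m : ℕ}
    {b c : ℝ} (hm : m ≤ n) (hcb : c < b) (hKc : ∀ y ∈ Kᶜ, c < y → b < y)
    (hg : EqOn g (taylorWithinEval f n K b) (Ioi b)) :
    Tendsto (iteratedDeriv m g) (𝓝[Kᶜ] b) (𝓝 (iteratedDerivWithin m f K b)) := by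
  have hP : Tendsto (iteratedDeriv m (taylorWithinEval f n K b)) (𝓝[Kᶜ] b)
      (𝓝 (iteratedDerivWithin m f K b)) := by
    rw [← iteratedDeriv_taylorWithinEval_self hm]
    exact (((contDiff_taylorWithinEval f n K b).continuous_iteratedDeriv' m).tendsto b).mono_left
      nhdsWithin_le_nhds
  refine hP.congr' ?_
  have hc : ∀ᶠ y in 𝓝[Kᶜ] b, y ∈ Kᶜ ∧ y ∈ Ioi c :=
    eventually_mem_nhdsWithin.and (mem_nhdsWithin_of_mem_nhds (Ioi_mem_nhds hcb))
  filter_upwards [hc] with y hy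
  have hyb : b < y := hKc y hy.1 hy.2
  have hloc : g =ᶠ[𝓝 y] taylorWithinEval f n K b := by
    filter_upwards [Ioi_mem_nhds hyb] with z hz using hg hz
  rw [iteratedDeriv_eq_iteratedFDeriv, iteratedDeriv_eq_iteratedFDeriv,
    (hloc.iteratedFDeriv ℝ m).eq_of_nhds]

/-! ### The extension theorems -/

/-- **`Cᴺ` extension from a closed half-line** (Whitney's extension theorem, `m = N` finite, for
`K = [a, ∞) ⊆ ℝ`): if `f` is `Cᴺ` on `[a, ∞)` in the within sense, there is `G : ℝ → F` of class
`Cᴺ` on `ℝ` with `G = f` on `[a, ∞)` and `G⁽ᵐ⁾(x) = f⁽ᵐ⁾_{[a,∞)}(x)` for all `m ≤ N`, `x ≥ a` (at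
`x = a`: the right derivatives).  `G` is `f` continued to the left of `a` by the Taylor polynomial
of order `N` of `f` at `a⁺`. [cite: Whitney1934, Thm. I (case m finite)] -/
theorem exists_contDiff_extension_Ici {N : ℕ} {f : ℝ → F} {a : ℝ}
    (hf : ContDiffOn ℝ N f (Ici a)) :
    ∃ G : ℝ → F, ContDiff ℝ N G ∧ EqOn G f (Ici a) ∧
      ∀ m : ℕ, m ≤ N → ∀ x ∈ Ici a, iteratedDeriv m G x = iteratedDerivWithin m f (Ici a) x := by
  classical
  set P := taylorWithinEval f N (Ici a) a with hP
  let G : ℝ → F := fun x ↦ if a ≤ x then f x else P x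
  have hGf : EqOn G f (Ici a) := fun x hx ↦ if_pos hx
  have hGP : EqOn G P (Iio a) := fun x hx ↦ if_neg (not_le.2 hx)
  have hGc : ContDiffOn ℝ N G (Ici a)ᶜ := by
    rw [compl_Ici]
    exact (contDiff_taylorWithinEval f N (Ici a) a).contDiffOn.congr hGP
  have hlim : ∀ m : ℕ, m ≤ N → ∀ x ∈ Ici a,
      Tendsto (iteratedDeriv m G) (𝓝[(Ici a)ᶜ] x) (𝓝 (iteratedDerivWithin m f (Ici a) x)) := by
    intro m hm x hx
    rcases eq_or_lt_of_le (mem_Ici.1 hx) with rfl | hax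
    · exact tendsto_iteratedDeriv_of_eqOn_taylor_left hm (lt_add_one _)
        (fun y hy _ ↦ by simpa using hy) hGP
    · exact tendsto_nhdsWithin_compl_of_mem_interior (by rw [interior_Ici]; exact hax)
  obtain ⟨h1, h2⟩ :=
    contDiff_of_tendsto_iteratedDeriv isClosed_Ici (uniqueDiffOn_Ici a) hf hGc hGf hlim
  exact ⟨G, h1, hGf, h2⟩

/-- **`Cᴺ` extension from a compact interval** (Whitney's extension theorem, `m = N` finite, for
`K = [a, b] ⊆ ℝ`, `a < b`): if `f` is `Cᴺ` on `[a, b]` in the within sense, there is `G : ℝ → F`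
of class `Cᴺ` on `ℝ` with `G = f` on `[a, b]` and `G⁽ᵐ⁾(x) = f⁽ᵐ⁾_{[a,b]}(x)` for all `m ≤ N`,
`x ∈ [a, b]` (one-sided derivatives at the endpoints).  `G` is `f` continued beyond each endpoint
by the Taylor polynomial of order `N` of `f` there. [cite: Whitney1934, Thm. I (case m finite)] -/
theorem exists_contDiff_extension_Icc {N : ℕ} {f : ℝ → F} {a b : ℝ} (hab : a < b)
    (hf : ContDiffOn ℝ N f (Icc a b)) :
    ∃ G : ℝ → F, ContDiff ℝ N G ∧ EqOn G f (Icc a b) ∧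
      ∀ m : ℕ, m ≤ N → ∀ x ∈ Icc a b,
        iteratedDeriv m G x = iteratedDerivWithin m f (Icc a b) x := by
  classical
  set P := taylorWithinEval f N (Icc a b) a with hP
  set Q := taylorWithinEval f N (Icc a b) b with hQ
  let G : ℝ → F := fun x ↦ if x < a then P x else if x ≤ b then f x else Q x
  have hGf : EqOn G f (Icc a b) := fun x hx ↦ by
    simp [G, not_lt.2 hx.1, hx.2]
  have hGP : EqOn G P (Iio a) := fun x hx ↦ by
    simp [G, mem_Iio.1 hx]
  have hGQ : EqOn G Q (Ioi b) := fun x hx ↦ by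
    have hx' : b < x := hx
    simp [G, not_lt.2 (hab.le.trans hx'.le), not_le.2 hx']
  have hGc : ContDiffOn ℝ N G (Icc a b)ᶜ := by
    intro y hy
    by_cases hya : y < a
    · have hloc : G =ᶠ[𝓝 y] P := by
        filter_upwards [Iio_mem_nhds hya] with z hz using hGP hz
      exact ((contDiff_taylorWithinEval f N (Icc a b) a).contDiffAt.congr_of_eventuallyEq
        hloc).contDiffWithinAt
    · have hyb : b < y := by
        by_contra h
        exact hy ⟨not_lt.1 hya, not_lt.1 h⟩
      have hloc : G =ᶠ[𝓝 y] Q := by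
        filter_upwards [Ioi_mem_nhds hyb] with z hz using hGQ hz
      exact ((contDiff_taylorWithinEval f N (Icc a b) b).contDiffAt.congr_of_eventuallyEq
        hloc).contDiffWithinAt
  have hlim : ∀ m : ℕ, m ≤ N → ∀ x ∈ Icc a b,
      Tendsto (iteratedDeriv m G) (𝓝[(Icc a b)ᶜ] x) (𝓝 (iteratedDerivWithin m f (Icc a b) x)) := by
    intro m hm x hx
    rcases eq_or_lt_of_le hx.1 with h₁ | hax
    · subst h₁
      refine tendsto_iteratedDeriv_of_eqOn_taylor_left hm hab (fun y hy hyb ↦ ?_) hGP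
      by_contra h
      exact hy ⟨not_lt.1 h, hyb.le⟩
    rcases eq_or_lt_of_le hx.2 with h₂ | hxb
    · subst h₂
      refine tendsto_iteratedDeriv_of_eqOn_taylor_right hm hab (fun y hy hay ↦ ?_) hGQ
      by_contra h
      exact hy ⟨hay.le, not_lt.1 h⟩
    · exact tendsto_nhdsWithin_compl_of_mem_interior (by rw [interior_Icc]; exact ⟨hax, hxb⟩)
  obtain ⟨h1, h2⟩ :=
    contDiff_of_tendsto_iteratedDeriv isClosed_Icc (uniqueDiffOn_Icc hab) hf hGc hGf hlim
  exact ⟨G, h1, hGf, h2⟩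

/-! ### First-order corollaries -/

/-- `Cᴺ` extension from `[a, ∞)`, `N ≥ 1`, with `G′ = f′_{[a,∞)}` on `[a, ∞)`; in particular
`G′(a)` is the right derivative of `f` at `a`. [cite: Whitney1934, Thm. I (case m finite)] -/
theorem exists_contDiff_extension_Ici_deriv {N : ℕ} (hN : 1 ≤ N) {f : ℝ → F} {a : ℝ}
    (hf : ContDiffOn ℝ N f (Ici a)) :
    ∃ G : ℝ → F, ContDiff ℝ N G ∧ EqOn G f (Ici a) ∧
      ∀ x ∈ Ici a, deriv G x = derivWithin f (Ici a) x := by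
  obtain ⟨G, hG, hGf, hD⟩ := exists_contDiff_extension_Ici hf
  refine ⟨G, hG, hGf, fun x hx ↦ ?_⟩
  simpa only [iteratedDeriv_one, iteratedDerivWithin_one] using hD 1 hN x hx

/-- `Cᴺ` extension from `[a, b]`, `a < b`, `N ≥ 1`, with `G′ = f′_{[a,b]}` on `[a, b]`.
[cite: Whitney1934, Thm. I (case m finite)] -/
theorem exists_contDiff_extension_Icc_deriv {N : ℕ} (hN : 1 ≤ N) {f : ℝ → F} {a b : ℝ}
    (hab : a < b) (hf : ContDiffOn ℝ N f (Icc a b)) :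
    ∃ G : ℝ → F, ContDiff ℝ N G ∧ EqOn G f (Icc a b) ∧
      ∀ x ∈ Icc a b, deriv G x = derivWithin f (Icc a b) x := by
  obtain ⟨G, hG, hGf, hD⟩ := exists_contDiff_extension_Icc hab hf
  refine ⟨G, hG, hGf, fun x hx ↦ ?_⟩
  simpa only [iteratedDeriv_one, iteratedDerivWithin_one] using hD 1 hN x hx

/-- At the left endpoint the derivative within `[a, b]` is the right derivative (within `[a, ∞)`).
[folklore] -/
private theorem derivWithin_Icc_left {f : ℝ → F} {a b : ℝ} (hab : a < b) :
    derivWithin f (Icc a b) a = derivWithin f (Ici a) a := by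
  rw [← Ici_inter_Iic, derivWithin_inter (Iic_mem_nhds hab)]

/-- **The `C²` shape used for one-sided densities.**  If `f` is `C²` on `[0, L]` (`L > 0`) in the
within sense, there is `G ∈ C²(ℝ)` with `G = f` on `[0, L]` and `G′(0) = f′(0⁺)` (the right
derivative of `f` at `0`).  This is the form in which a density known on `[0, ∞)` with a right
derivative at `0` — such as `x ↦ ε(eˣ)`, `x ≥ 0`, with `ε′(1₊)`, for the even functional
`E₊(F) = ∫ F(x) ε(e^{|x|}) dx` of `Literature.NumberTheory.ConnesConsani2021.evenFunctional` —
meets a hypothesis "`G ∈ C²(ℝ)`, `G′(0) = e′`". [cite: Whitney1934, Thm. I (case m finite)] -/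
theorem exists_contDiff_two_extension_Icc {f : ℝ → F} {L : ℝ} (hL : 0 < L)
    (hf : ContDiffOn ℝ 2 f (Icc 0 L)) :
    ∃ G : ℝ → F, ContDiff ℝ 2 G ∧ EqOn G f (Icc 0 L) ∧ deriv G 0 = derivWithin f (Ici 0) 0 := by
  obtain ⟨G, hG, hGf, hD⟩ := exists_contDiff_extension_Icc_deriv (N := 2) one_le_two hL hf
  exact ⟨G, hG, hGf, by rw [hD 0 (left_mem_Icc.2 hL.le), derivWithin_Icc_left hL]⟩

/-- The same from the closed half-line `[0, ∞)`. [cite: Whitney1934, Thm. I (case m finite)] -/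
theorem exists_contDiff_two_extension_Ici {f : ℝ → F} (hf : ContDiffOn ℝ 2 f (Ici 0)) :
    ∃ G : ℝ → F, ContDiff ℝ 2 G ∧ EqOn G f (Ici 0) ∧ deriv G 0 = derivWithin f (Ici 0) 0 := by
  obtain ⟨G, hG, hGf, hD⟩ := exists_contDiff_extension_Ici_deriv (N := 2) one_le_two hf
  exact ⟨G, hG, hGf, hD 0 self_mem_Ici⟩

end Literature.Analysis.Calculus

end
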